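import Summits.CriticalPhenomena.PercolationContinuityZ3.Theorems.Transplant.FKConnectivityAllQAntipodalRootFormBaseSer
import Summits.CriticalPhenomena.PercolationContinuityZ3.Theorems.Transplant.FKConnectivityAllQAntipodalRootFormCertPar

/-!
# Connectivity correlation inequalities for `φ_{w,q}`, every `q > 0` — ROOT-FORM CALCULUS, file 61i: base (B3) — a parallel free edge over the
# SERIES pair, `g ∥ (B_y · B_z)` — from the kernel-checked certificate

Support file (`--supports stmt-CriticalPhenomena-4575`), FK sub-lane `prim-bschramm-fk-2` (gen 28); builds on p205010 (kernel theorem, internal audit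
signed; external expert review pending).  Standard axioms, no sorries.  Memo FROM-fk-2-g28-ROOT-FORM.md §4, §6 (certificate j207955), §7.

`serPair_parE_Mt_nonneg`: the nested root functional of `parE (serPair Y Z)` (= the 4-sub-slot functional `Q` of the series pair) is nonnegative
against every monotone nested nonnegative weight pair, given the single-box inequalities A2 / A3n / A4n of the two abstract boxes, the contracted AND
of the series pair (a `q`-free AND⁺ instance for real pairs), and the consistency of the local types.  Links of the four sub-slot integrands with the
type-level table of file 61h, the two halves `certY3_nonneg` / `certZ3_nonneg` (per fibre, split by the first class bit), and the four-sub-slot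
transport `four_slot`.  With files 61c (word theorem), 61g ((B2)) this is ★(Δ) in root form for every spine word; with 61e ((B1)) ★(Θ). [folklore]
-/

noncomputable section

namespace Summit.CriticalPhenomena.PercolationContinuityZ3.Theorems

namespace FK

namespace RootForm

namespace BasePar

open Finset Base BaseSer

/-! ### Links for `g ∥ (B_y · B_z)` -/

/-- level bracket of `g ∥ (B_y·B_z)` at `g`-state `b`, box states `(s,s')`, replica-1 root. [folklore] -/
theorem a1_linkP (dy dz : BDat) (b s s' : Bool) (J : ℤ) : ((combS (dy.ts s) (dz.ts s')).par b).a1 J =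
    ((Cert.I (Cert.lam3 b dy.type dz.type s s' + Cert.K13 b dy.type dz.type s s' ≤ J - dz.t0.L - dy.t0.L) : ℤ) : ℝ) := by
  unfold PDat.a1; refine ind_eq_cast ?_
  cases b <;> cases s <;> cases s' <;>
    simp [combS, BDat.ts, BDat.type, PDat.par, Cert.lam3, Cert.K13, Cert.plamS, Cert.lev, Cert.ccB, Cert.cbB, Cert.C1S, Cert.C2S] <;> omega
/-- replica-2 root. [folklore] -/
theorem a2_linkP (dy dz : BDat) (b s s' : Bool) (J : ℤ) : ((combS (dy.ts s) (dz.ts s')).par b).a2 J =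
    ((Cert.I (Cert.lam3 b dy.type dz.type s s' + Cert.K23 b dy.type dz.type s s' ≤ J - dz.t0.L - dy.t0.L) : ℤ) : ℝ) := by
  unfold PDat.a2; refine ind_eq_cast ?_
  cases b <;> cases s <;> cases s' <;>
    simp [combS, BDat.ts, BDat.type, PDat.par, Cert.lam3, Cert.K23, Cert.plamS, Cert.lev, Cert.ccB, Cert.cbB, Cert.C1S, Cert.C2S] <;> omega
/-- root exchange, replica 1. [folklore] -/
theorem r1_linkP (dy dz : BDat) (b s s' : Bool) (J : ℤ) : ((combS (dy.ts s) (dz.ts s')).par b).r1 J =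
    ((Cert.I (Cert.lam3 b dy.type dz.type s s' = J - dz.t0.L - dy.t0.L) * Cert.K13 b dy.type dz.type s s' : ℤ) : ℝ) := by
  have hb : Cert.K13 b dy.type dz.type s s' = Cert.bi (b || ((dy.ts s).c && (dz.ts s').c)) := by
    cases b <;> cases s <;> cases s' <;> rfl
  rw [hb]; unfold PDat.r1
  exact ind_and_eq_cast (Q := Cert.lam3 b dy.type dz.type s s' = J - dz.t0.L - dy.t0.L)
    (by cases b <;> cases s <;> cases s' <;>
          simp [combS, BDat.ts, BDat.type, PDat.par, Cert.lam3, Cert.plamS, Cert.lev, Cert.ccB, Cert.cbB, Cert.C1S, Cert.C2S] <;> omega) _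
/-- root exchange, replica 2. [folklore] -/
theorem r2_linkP (dy dz : BDat) (b s s' : Bool) (J : ℤ) : ((combS (dy.ts s) (dz.ts s')).par b).r2 J =
    ((Cert.I (Cert.lam3 b dy.type dz.type s s' = J - dz.t0.L - dy.t0.L) * Cert.K23 b dy.type dz.type s s' : ℤ) : ℝ) := by
  have hb : Cert.K23 b dy.type dz.type s s' = Cert.bi (!b || ((dy.ts s).cb && (dz.ts s').cb)) := by
    cases b <;> cases s <;> cases s' <;> rfl
  rw [hb]; unfold PDat.r2
  exact ind_and_eq_cast (Q := Cert.lam3 b dy.type dz.type s s' = J - dz.t0.L - dy.t0.L)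
    (by cases b <;> cases s <;> cases s' <;>
          simp [combS, BDat.ts, BDat.type, PDat.par, Cert.lam3, Cert.plamS, Cert.lev, Cert.ccB, Cert.cbB, Cert.C1S, Cert.C2S] <;> omega) _

/-- slot-1 integrand of `g ∥ (B_y·B_z)` at `g`-state `b` = cast of `X31 b`. [folklore] -/
theorem slot1_linkP {B B' : Type*} (Y : B → BDat) (Z : B' → BDat) (b : Bool) (p : B × B') (J : ℤ) :
    (parE (serPair Y Z) (b, p)).slot1 J = ((Cert.X31 b (Y p.1).type (Z p.2).type (J - (Z p.2).t0.L - (Y p.1).t0.L) : ℤ) : ℝ) := by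
  have e0 : (parE (serPair Y Z) (b, p)).d0 = (combS ((Y p.1).ts false) ((Z p.2).ts false)).par b := rfl
  have ey : (parE (serPair Y Z) (b, p)).dy = (combS ((Y p.1).ts true) ((Z p.2).ts false)).par b := rfl
  have ez : (parE (serPair Y Z) (b, p)).dz = (combS ((Y p.1).ts false) ((Z p.2).ts true)).par b := rfl
  have eyz : (parE (serPair Y Z) (b, p)).dyz = (combS ((Y p.1).ts true) ((Z p.2).ts true)).par b := rfl
  simp only [EDat.slot1, e0, ey, ez, eyz, a1_linkP, r1_linkP, Cert.X31]; push_cast; ring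
/-- slot-0 integrand of `g ∥ (B_y·B_z)` at `g`-state `b` = cast of `X30 b`. [folklore] -/
theorem slot0_linkP {B B' : Type*} (Y : B → BDat) (Z : B' → BDat) (b : Bool) (p : B × B') (J : ℤ) :
    (parE (serPair Y Z) (b, p)).slot0 J = ((Cert.X30 b (Y p.1).type (Z p.2).type (J - (Z p.2).t0.L - (Y p.1).t0.L) : ℤ) : ℝ) := by
  have e0 : (parE (serPair Y Z) (b, p)).d0 = (combS ((Y p.1).ts false) ((Z p.2).ts false)).par b := rfl
  have ey : (parE (serPair Y Z) (b, p)).dy = (combS ((Y p.1).ts true) ((Z p.2).ts false)).par b := rfl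
  have ez : (parE (serPair Y Z) (b, p)).dz = (combS ((Y p.1).ts false) ((Z p.2).ts true)).par b := rfl
  have eyz : (parE (serPair Y Z) (b, p)).dyz = (combS ((Y p.1).ts true) ((Z p.2).ts true)).par b := rfl
  simp only [EDat.slot0, e0, ey, ez, eyz, a2_linkP, r2_linkP, Cert.X30]; push_cast; ring
/-- contracted AND of the series pair = cast of `ANDconS`. [folklore] -/
theorem andCon_linkS {B B' : Type*} (Y : B → BDat) (Z : B' → BDat) (p : B × B') (J : ℤ) :
    (serPair Y Z p).andCon J = ((Cert.ANDconS (Y p.1).type (Z p.2).type (J - (Z p.2).t0.L - (Y p.1).t0.L) : ℤ) : ℝ) := by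
  have h1 : ∀ s : Bool, (combS ((Y p.1).ts s) ((Z p.2).ts s)).acon J = ((Cert.I (Cert.plamS (Y p.1).type (Z p.2).type s s
      + Cert.C1S (Y p.1).type (Z p.2).type s s + Cert.C2S (Y p.1).type (Z p.2).type s s ≤ J - (Z p.2).t0.L - (Y p.1).t0.L) : ℤ) : ℝ) := by
    intro s; unfold PDat.acon; refine ind_eq_cast ?_
    cases s <;> simp [combS, BDat.ts, BDat.type, Cert.plamS, Cert.lev, Cert.ccB, Cert.cbB, Cert.C1S, Cert.C2S] <;> omega
  have e0 : (serPair Y Z p).d0 = combS ((Y p.1).ts false) ((Z p.2).ts false) := rfl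
  have eyz : (serPair Y Z p).dyz = combS ((Y p.1).ts true) ((Z p.2).ts true) := rfl
  simp only [EDat.andCon, e0, eyz, h1, Cert.ANDconS]; push_cast; ring

/-- `3·x = x+x+x` over `ℤ` (for `simp`). [folklore] -/
theorem three_mul' (x : ℤ) : 3 * x = x + x + x := by ring
/-- `4·x = x+x+x+x` over `ℤ` (for `simp`). [folklore] -/
theorem four_mul' (x : ℤ) : 4 * x = x + x + x + x := by ring

/-- The four-sub-slot transport: weights ordered along the poset `00 ≤ 01 ≤ 11`, `00 ≤ 10 ≤ 11` and the five up-set conditions give a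
nonnegative total. [folklore] -/
theorem four_slot (h11 h10 h01 h00 r11 r10 r01 r00 : ℝ) (n00 : 0 ≤ h00) (a1 : h00 ≤ h01) (a2 : h01 ≤ h11) (a3 : h00 ≤ h10) (a4 : h10 ≤ h11)
    (c1 : 0 ≤ r11) (c2 : 0 ≤ r11 + r10) (c3 : 0 ≤ r11 + r01) (c4 : 0 ≤ r11 + r10 + r01) (c5 : 0 ≤ r11 + r10 + r01 + r00) :
    0 ≤ h11 * r11 + h10 * r10 + h01 * r01 + h00 * r00 := by
  rcases le_total h10 h01 with h | h
  · nlinarith [mul_nonneg n00 c5, mul_nonneg (sub_nonneg.2 a3) c4, mul_nonneg (sub_nonneg.2 h) c3, mul_nonneg (sub_nonneg.2 a2) c1]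
  · nlinarith [mul_nonneg n00 c5, mul_nonneg (sub_nonneg.2 a1) c4, mul_nonneg (sub_nonneg.2 h) c2, mul_nonneg (sub_nonneg.2 a4) c1]

section Halves

variable {B B' : Type*} [Fintype B] [Fintype B'] [Preorder B] [Preorder B']

omit [Fintype B] [Fintype B'] in
/-- sections of a monotone weight on `Bool × (B × B')` at fixed `(b, γ)` are monotone in `β`. [folklore] -/
theorem mono_midL {H : Bool × (B × B') → ℝ} (hH : Monotone H) (b : Bool) (γ : B') : Monotone fun β => H (b, (β, γ)) :=
  fun _ _ h => hH (Prod.mk_le_mk.2 ⟨le_rfl, Prod.mk_le_mk.2 ⟨h, le_rfl⟩⟩)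
omit [Fintype B] [Fintype B'] in
/-- sections at fixed `(b, β)` are monotone in `γ`. [folklore] -/
theorem mono_midR {H : Bool × (B × B') → ℝ} (hH : Monotone H) (b : Bool) (β : B) : Monotone fun γ => H (b, (β, γ)) :=
  fun _ _ h => hH (Prod.mk_le_mk.2 ⟨le_rfl, Prod.mk_le_mk.2 ⟨le_rfl, h⟩⟩)
omit [Fintype B] [Fintype B'] in
/-- monotone in the state of `g`. [folklore] -/
theorem mono_b {H : Bool × (B × B') → ℝ} (hH : Monotone H) (p : B × B') : H (false, p) ≤ H (true, p) :=
  hH (Prod.mk_le_mk.2 ⟨Bool.false_le _, le_rfl⟩)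

omit [Fintype B'] in
/-- **the `y`-half of the (B3) certificate is nonnegative** (per fixed `z`-configuration; the four sub-slot weights
`H₁(t,·,γ) ≥ H₁(f,·,γ), H₀(t,·,γ) ≥ H₀(f,·,γ)`). (case `c⁰ = false` of the fibre). [folklore] -/
theorem certY3_nonneg_f (Y : B → BDat) (Z : B' → BDat)
    (hA2 : ∀ h : B → ℝ, Monotone h → (∀ β, 0 ≤ h β) → ∀ K : ℤ, 0 ≤ ∑ β, h β * gA2 (Y β) K)
    (hA3 : ∀ h0 h1 : B → ℝ, Monotone h0 → Monotone h1 → (∀ β, 0 ≤ h0 β) → (∀ β, h0 β ≤ h1 β) → ∀ K : ℤ,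
      0 ≤ ∑ β, (h1 β * gA3u (Y β) K + h0 β * gA3l (Y β) K))
    (hA4 : ∀ h0 h1 : B → ℝ, Monotone h0 → Monotone h1 → (∀ β, 0 ≤ h0 β) → (∀ β, h0 β ≤ h1 β) → ∀ K : ℤ,
      0 ≤ ∑ β, (h1 β * gA4u (Y β) K + h0 β * gA4l (Y β) K))
    {H0 H1 : Bool × (B × B') → ℝ} (m0 : Monotone H0) (m1 : Monotone H1) (n0 : ∀ p, 0 ≤ H0 p) (le : ∀ p, H0 p ≤ H1 p) (J : ℤ) (γ : B') (hcv : (Z γ).t0.c = false) :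
    0 ≤ ∑ β, (H1 (true, (β, γ)) * ((Cert.certY3 (Y β).type (Z γ).type ((J - (Z γ).t0.L - 1) - (Y β).t0.L)
        ((J - (Z γ).t1.L - 1) - (Y β).t0.L)).1 : ℝ)
      + H1 (false, (β, γ)) * ((Cert.certY3 (Y β).type (Z γ).type ((J - (Z γ).t0.L - 1) - (Y β).t0.L)
        ((J - (Z γ).t1.L - 1) - (Y β).t0.L)).2.1 : ℝ)
      + H0 (true, (β, γ)) * ((Cert.certY3 (Y β).type (Z γ).type ((J - (Z γ).t0.L - 1) - (Y β).t0.L)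
        ((J - (Z γ).t1.L - 1) - (Y β).t0.L)).2.2.1 : ℝ)
      + H0 (false, (β, γ)) * ((Cert.certY3 (Y β).type (Z γ).type ((J - (Z γ).t0.L - 1) - (Y β).t0.L)
        ((J - (Z γ).t1.L - 1) - (Y β).t0.L)).2.2.2 : ℝ)) := by
  have n1 : ∀ p, 0 ≤ H1 p := fun p => (n0 p).trans (le p)
  -- the four sub-slot weights at this fibre and their order relations
  have w11m := mono_midL m1 true γ; have w10m := mono_midL m1 false γ; have w01m := mono_midL m0 true γ; have w00m := mono_midL m0 false γ
  have l_10_11 : ∀ β, H1 (false, (β, γ)) ≤ H1 (true, (β, γ)) := fun β => mono_b m1 _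
  have l_00_01 : ∀ β, H0 (false, (β, γ)) ≤ H0 (true, (β, γ)) := fun β => mono_b m0 _
  have l_00_10 : ∀ β, H0 (false, (β, γ)) ≤ H1 (false, (β, γ)) := fun β => le _
  have l_01_11 : ∀ β, H0 (true, (β, γ)) ≤ H1 (true, (β, γ)) := fun β => le _
  have l_00_11 : ∀ β, H0 (false, (β, γ)) ≤ H1 (true, (β, γ)) := fun β => (le _).trans (mono_b m1 _)
  -- A2 instances (single sub-slot)
  have i2 : ∀ (w : B → ℝ), Monotone w → (∀ β, 0 ≤ w β) → ∀ K, 0 ≤ ∑ β, w β * gA2 (Y β) K := fun w hw hn K => hA2 w hw hn K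
  -- nested instances (A3n, A4n) and A4both
  have i3 : ∀ (w0 w1 : B → ℝ), Monotone w0 → Monotone w1 → (∀ β, 0 ≤ w0 β) → (∀ β, w0 β ≤ w1 β) → ∀ K,
      0 ≤ ∑ β, w1 β * gA3u (Y β) K + ∑ β, w0 β * gA3l (Y β) K := fun w0 w1 a b c d K => by
    rw [← Finset.sum_add_distrib]; exact hA3 w0 w1 a b c d K
  have i4 : ∀ (w0 w1 : B → ℝ), Monotone w0 → Monotone w1 → (∀ β, 0 ≤ w0 β) → (∀ β, w0 β ≤ w1 β) → ∀ K,
      0 ≤ ∑ β, w1 β * gA4u (Y β) K + ∑ β, w0 β * gA4l (Y β) K := fun w0 w1 a b c d K => by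
    rw [← Finset.sum_add_distrib]; exact hA4 w0 w1 a b c d K
  -- instantiate everything that can occur (2 thresholds × weights / weight pairs)
  have a := fun K => i2 _ w11m (fun β => n1 _) K; have b := fun K => i2 _ w10m (fun β => n1 _) K
  have c := fun K => i2 _ w01m (fun β => n0 _) K; have d := fun K => i2 _ w00m (fun β => n0 _) K
  have e := fun K => i3 _ _ w00m w01m (fun β => n0 _) l_00_01 K; have f := fun K => i3 _ _ w00m w11m (fun β => n0 _) l_00_11 K
  have g := fun K => i3 _ _ w10m w11m (fun β => n1 _) l_10_11 K; have h := fun K => i3 _ _ w00m w10m (fun β => n0 _) l_00_10 K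
  have e4 := fun K => i4 _ _ w00m w01m (fun β => n0 _) l_00_01 K; have f4 := fun K => i4 _ _ w00m w11m (fun β => n0 _) l_00_11 K
  have g4 := fun K => i4 _ _ w10m w11m (fun β => n1 _) l_10_11 K; have h4 := fun K => i4 _ _ w00m w10m (fun β => n0 _) l_00_10 K
  have b11 := fun K => i4 _ _ w11m w11m (fun β => n1 _) (fun β => le_rfl) K
  have b10 := fun K => i4 _ _ w10m w10m (fun β => n1 _) (fun β => le_rfl) K
  have b01 := fun K => i4 _ _ w01m w01m (fun β => n0 _) (fun β => le_rfl) K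
  have b00 := fun K => i4 _ _ w00m w00m (fun β => n0 _) (fun β => le_rfl) K
  have A := a (J - (Z γ).t0.L - 1); have A' := a (J - (Z γ).t1.L - 1); have Bq := b (J - (Z γ).t0.L - 1); have Bq' := b (J - (Z γ).t1.L - 1)
  have C := c (J - (Z γ).t0.L - 1); have C' := c (J - (Z γ).t1.L - 1); have D := d (J - (Z γ).t0.L - 1); have D' := d (J - (Z γ).t1.L - 1)
  have E := e (J - (Z γ).t0.L - 1); have E' := e (J - (Z γ).t1.L - 1); have Fq := f (J - (Z γ).t0.L - 1); have Fq' := f (J - (Z γ).t1.L - 1)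
  have G := g (J - (Z γ).t0.L - 1); have G' := g (J - (Z γ).t1.L - 1); have Hq := h (J - (Z γ).t0.L - 1); have Hq' := h (J - (Z γ).t1.L - 1)
  have E4 := e4 (J - (Z γ).t0.L - 1); have E4' := e4 (J - (Z γ).t1.L - 1); have F4 := f4 (J - (Z γ).t0.L - 1); have F4' := f4 (J - (Z γ).t1.L - 1)
  have G4 := g4 (J - (Z γ).t0.L - 1); have G4' := g4 (J - (Z γ).t1.L - 1); have H4 := h4 (J - (Z γ).t0.L - 1); have H4' := h4 (J - (Z γ).t1.L - 1)
  have B11 := b11 (J - (Z γ).t0.L - 1); have B11' := b11 (J - (Z γ).t1.L - 1); have B10 := b10 (J - (Z γ).t0.L - 1); have B10' := b10 (J - (Z γ).t1.L - 1)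
  have B01 := b01 (J - (Z γ).t0.L - 1); have B01' := b01 (J - (Z γ).t1.L - 1); have B00 := b00 (J - (Z γ).t0.L - 1); have B00' := b00 (J - (Z γ).t1.L - 1)
  clear a b c d e f g h e4 f4 g4 h4 b11 b10 b01 b00 i2 i3 i4
  simp only [gA2, gA3u, gA3l, gA4u, gA4l] at A A' Bq Bq' C C' D D' E E' Fq Fq' G G' Hq Hq' E4 E4' F4 F4' G4 G4' H4 H4' B11 B11' B10 B10' B01 B01' B00 B00'
  generalize (Z γ) = dz at *
  obtain ⟨⟨L0, c0, cb0⟩, ⟨L1, c1, cb1⟩⟩ := dz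
  simp only [BDat.type] at *
  subst hcv
  cases c1 <;> cases cb0 <;> cases cb1 <;>
    simp only [Cert.certY3, Cert.isC, Prod.mk.injEq, Bool.false_eq_true, Bool.true_eq_false, and_true, and_false,
      and_self, ite_true, ite_false, zero_mul, one_mul, mul_zero, mul_one, zero_add, add_zero, two_mul, four_mul',
      Int.cast_add, Int.cast_zero, mul_add, Finset.sum_add_distrib] <;>
    first | positivity | linarith

omit [Fintype B'] in
/-- **the `y`-half of the (B3) certificate is nonnegative** (per fixed `z`-configuration; the four sub-slot weights
`H₁(t,·,γ) ≥ H₁(f,·,γ), H₀(t,·,γ) ≥ H₀(f,·,γ)`). (case `c⁰ = true` of the fibre). [folklore] -/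
theorem certY3_nonneg_t (Y : B → BDat) (Z : B' → BDat)
    (hA2 : ∀ h : B → ℝ, Monotone h → (∀ β, 0 ≤ h β) → ∀ K : ℤ, 0 ≤ ∑ β, h β * gA2 (Y β) K)
    (hA3 : ∀ h0 h1 : B → ℝ, Monotone h0 → Monotone h1 → (∀ β, 0 ≤ h0 β) → (∀ β, h0 β ≤ h1 β) → ∀ K : ℤ,
      0 ≤ ∑ β, (h1 β * gA3u (Y β) K + h0 β * gA3l (Y β) K))
    (hA4 : ∀ h0 h1 : B → ℝ, Monotone h0 → Monotone h1 → (∀ β, 0 ≤ h0 β) → (∀ β, h0 β ≤ h1 β) → ∀ K : ℤ,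
      0 ≤ ∑ β, (h1 β * gA4u (Y β) K + h0 β * gA4l (Y β) K))
    {H0 H1 : Bool × (B × B') → ℝ} (m0 : Monotone H0) (m1 : Monotone H1) (n0 : ∀ p, 0 ≤ H0 p) (le : ∀ p, H0 p ≤ H1 p) (J : ℤ) (γ : B') (hcv : (Z γ).t0.c = true) :
    0 ≤ ∑ β, (H1 (true, (β, γ)) * ((Cert.certY3 (Y β).type (Z γ).type ((J - (Z γ).t0.L - 1) - (Y β).t0.L)
        ((J - (Z γ).t1.L - 1) - (Y β).t0.L)).1 : ℝ)
      + H1 (false, (β, γ)) * ((Cert.certY3 (Y β).type (Z γ).type ((J - (Z γ).t0.L - 1) - (Y β).t0.L)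
        ((J - (Z γ).t1.L - 1) - (Y β).t0.L)).2.1 : ℝ)
      + H0 (true, (β, γ)) * ((Cert.certY3 (Y β).type (Z γ).type ((J - (Z γ).t0.L - 1) - (Y β).t0.L)
        ((J - (Z γ).t1.L - 1) - (Y β).t0.L)).2.2.1 : ℝ)
      + H0 (false, (β, γ)) * ((Cert.certY3 (Y β).type (Z γ).type ((J - (Z γ).t0.L - 1) - (Y β).t0.L)
        ((J - (Z γ).t1.L - 1) - (Y β).t0.L)).2.2.2 : ℝ)) := by
  have n1 : ∀ p, 0 ≤ H1 p := fun p => (n0 p).trans (le p)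
  -- the four sub-slot weights at this fibre and their order relations
  have w11m := mono_midL m1 true γ; have w10m := mono_midL m1 false γ; have w01m := mono_midL m0 true γ; have w00m := mono_midL m0 false γ
  have l_10_11 : ∀ β, H1 (false, (β, γ)) ≤ H1 (true, (β, γ)) := fun β => mono_b m1 _
  have l_00_01 : ∀ β, H0 (false, (β, γ)) ≤ H0 (true, (β, γ)) := fun β => mono_b m0 _
  have l_00_10 : ∀ β, H0 (false, (β, γ)) ≤ H1 (false, (β, γ)) := fun β => le _
  have l_01_11 : ∀ β, H0 (true, (β, γ)) ≤ H1 (true, (β, γ)) := fun β => le _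
  have l_00_11 : ∀ β, H0 (false, (β, γ)) ≤ H1 (true, (β, γ)) := fun β => (le _).trans (mono_b m1 _)
  -- A2 instances (single sub-slot)
  have i2 : ∀ (w : B → ℝ), Monotone w → (∀ β, 0 ≤ w β) → ∀ K, 0 ≤ ∑ β, w β * gA2 (Y β) K := fun w hw hn K => hA2 w hw hn K
  -- nested instances (A3n, A4n) and A4both
  have i3 : ∀ (w0 w1 : B → ℝ), Monotone w0 → Monotone w1 → (∀ β, 0 ≤ w0 β) → (∀ β, w0 β ≤ w1 β) → ∀ K,
      0 ≤ ∑ β, w1 β * gA3u (Y β) K + ∑ β, w0 β * gA3l (Y β) K := fun w0 w1 a b c d K => by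
    rw [← Finset.sum_add_distrib]; exact hA3 w0 w1 a b c d K
  have i4 : ∀ (w0 w1 : B → ℝ), Monotone w0 → Monotone w1 → (∀ β, 0 ≤ w0 β) → (∀ β, w0 β ≤ w1 β) → ∀ K,
      0 ≤ ∑ β, w1 β * gA4u (Y β) K + ∑ β, w0 β * gA4l (Y β) K := fun w0 w1 a b c d K => by
    rw [← Finset.sum_add_distrib]; exact hA4 w0 w1 a b c d K
  -- instantiate everything that can occur (2 thresholds × weights / weight pairs)
  have a := fun K => i2 _ w11m (fun β => n1 _) K; have b := fun K => i2 _ w10m (fun β => n1 _) K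
  have c := fun K => i2 _ w01m (fun β => n0 _) K; have d := fun K => i2 _ w00m (fun β => n0 _) K
  have e := fun K => i3 _ _ w00m w01m (fun β => n0 _) l_00_01 K; have f := fun K => i3 _ _ w00m w11m (fun β => n0 _) l_00_11 K
  have g := fun K => i3 _ _ w10m w11m (fun β => n1 _) l_10_11 K; have h := fun K => i3 _ _ w00m w10m (fun β => n0 _) l_00_10 K
  have e4 := fun K => i4 _ _ w00m w01m (fun β => n0 _) l_00_01 K; have f4 := fun K => i4 _ _ w00m w11m (fun β => n0 _) l_00_11 K
  have g4 := fun K => i4 _ _ w10m w11m (fun β => n1 _) l_10_11 K; have h4 := fun K => i4 _ _ w00m w10m (fun β => n0 _) l_00_10 K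
  have b11 := fun K => i4 _ _ w11m w11m (fun β => n1 _) (fun β => le_rfl) K
  have b10 := fun K => i4 _ _ w10m w10m (fun β => n1 _) (fun β => le_rfl) K
  have b01 := fun K => i4 _ _ w01m w01m (fun β => n0 _) (fun β => le_rfl) K
  have b00 := fun K => i4 _ _ w00m w00m (fun β => n0 _) (fun β => le_rfl) K
  have A := a (J - (Z γ).t0.L - 1); have A' := a (J - (Z γ).t1.L - 1); have Bq := b (J - (Z γ).t0.L - 1); have Bq' := b (J - (Z γ).t1.L - 1)
  have C := c (J - (Z γ).t0.L - 1); have C' := c (J - (Z γ).t1.L - 1); have D := d (J - (Z γ).t0.L - 1); have D' := d (J - (Z γ).t1.L - 1)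
  have E := e (J - (Z γ).t0.L - 1); have E' := e (J - (Z γ).t1.L - 1); have Fq := f (J - (Z γ).t0.L - 1); have Fq' := f (J - (Z γ).t1.L - 1)
  have G := g (J - (Z γ).t0.L - 1); have G' := g (J - (Z γ).t1.L - 1); have Hq := h (J - (Z γ).t0.L - 1); have Hq' := h (J - (Z γ).t1.L - 1)
  have E4 := e4 (J - (Z γ).t0.L - 1); have E4' := e4 (J - (Z γ).t1.L - 1); have F4 := f4 (J - (Z γ).t0.L - 1); have F4' := f4 (J - (Z γ).t1.L - 1)
  have G4 := g4 (J - (Z γ).t0.L - 1); have G4' := g4 (J - (Z γ).t1.L - 1); have H4 := h4 (J - (Z γ).t0.L - 1); have H4' := h4 (J - (Z γ).t1.L - 1)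
  have B11 := b11 (J - (Z γ).t0.L - 1); have B11' := b11 (J - (Z γ).t1.L - 1); have B10 := b10 (J - (Z γ).t0.L - 1); have B10' := b10 (J - (Z γ).t1.L - 1)
  have B01 := b01 (J - (Z γ).t0.L - 1); have B01' := b01 (J - (Z γ).t1.L - 1); have B00 := b00 (J - (Z γ).t0.L - 1); have B00' := b00 (J - (Z γ).t1.L - 1)
  clear a b c d e f g h e4 f4 g4 h4 b11 b10 b01 b00 i2 i3 i4
  simp only [gA2, gA3u, gA3l, gA4u, gA4l] at A A' Bq Bq' C C' D D' E E' Fq Fq' G G' Hq Hq' E4 E4' F4 F4' G4 G4' H4 H4' B11 B11' B10 B10' B01 B01' B00 B00'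
  generalize (Z γ) = dz at *
  obtain ⟨⟨L0, c0, cb0⟩, ⟨L1, c1, cb1⟩⟩ := dz
  simp only [BDat.type] at *
  subst hcv
  cases c1 <;> cases cb0 <;> cases cb1 <;>
    simp only [Cert.certY3, Cert.isC, Prod.mk.injEq, Bool.false_eq_true, Bool.true_eq_false, and_true, and_false,
      and_self, ite_true, ite_false, zero_mul, mul_zero, mul_one, zero_add, add_zero, two_mul,
      Int.cast_add, Int.cast_zero, mul_add, Finset.sum_add_distrib] <;>
    first | positivity | linarith

omit [Fintype B'] in
/-- **the `y`-half of the (B3) certificate is nonnegative** (per fixed `z`-configuration; the four sub-slot weights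
`H₁(t,·,γ) ≥ H₁(f,·,γ), H₀(t,·,γ) ≥ H₀(f,·,γ)`). [folklore] -/
theorem certY3_nonneg (Y : B → BDat) (Z : B' → BDat)
    (hA2 : ∀ h : B → ℝ, Monotone h → (∀ β, 0 ≤ h β) → ∀ K : ℤ, 0 ≤ ∑ β, h β * gA2 (Y β) K)
    (hA3 : ∀ h0 h1 : B → ℝ, Monotone h0 → Monotone h1 → (∀ β, 0 ≤ h0 β) → (∀ β, h0 β ≤ h1 β) → ∀ K : ℤ,
      0 ≤ ∑ β, (h1 β * gA3u (Y β) K + h0 β * gA3l (Y β) K))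
    (hA4 : ∀ h0 h1 : B → ℝ, Monotone h0 → Monotone h1 → (∀ β, 0 ≤ h0 β) → (∀ β, h0 β ≤ h1 β) → ∀ K : ℤ,
      0 ≤ ∑ β, (h1 β * gA4u (Y β) K + h0 β * gA4l (Y β) K))
    {H0 H1 : Bool × (B × B') → ℝ} (m0 : Monotone H0) (m1 : Monotone H1) (n0 : ∀ p, 0 ≤ H0 p) (le : ∀ p, H0 p ≤ H1 p) (J : ℤ) (γ : B') :
    0 ≤ ∑ β, (H1 (true, (β, γ)) * ((Cert.certY3 (Y β).type (Z γ).type ((J - (Z γ).t0.L - 1) - (Y β).t0.L)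
        ((J - (Z γ).t1.L - 1) - (Y β).t0.L)).1 : ℝ)
      + H1 (false, (β, γ)) * ((Cert.certY3 (Y β).type (Z γ).type ((J - (Z γ).t0.L - 1) - (Y β).t0.L)
        ((J - (Z γ).t1.L - 1) - (Y β).t0.L)).2.1 : ℝ)
      + H0 (true, (β, γ)) * ((Cert.certY3 (Y β).type (Z γ).type ((J - (Z γ).t0.L - 1) - (Y β).t0.L)
        ((J - (Z γ).t1.L - 1) - (Y β).t0.L)).2.2.1 : ℝ)
      + H0 (false, (β, γ)) * ((Cert.certY3 (Y β).type (Z γ).type ((J - (Z γ).t0.L - 1) - (Y β).t0.L)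
        ((J - (Z γ).t1.L - 1) - (Y β).t0.L)).2.2.2 : ℝ)) := by
  rcases Bool.eq_false_or_eq_true ((Z γ).t0.c) with hc | hc
  · exact certY3_nonneg_t Y Z hA2 hA3 hA4 m0 m1 n0 le J γ hc
  · exact certY3_nonneg_f Y Z hA2 hA3 hA4 m0 m1 n0 le J γ hc


end Halves

end BasePar

end RootForm

end FK

end Summit.CriticalPhenomena.PercolationContinuityZ3.Theorems
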